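import Literature.MathematicalPhysics.QuantumFieldTheory.Balaban1983to89.B6DivLegNormSuppKLevelV1
import Literature.MathematicalPhysics.QuantumFieldTheory.Balaban1983to89.B6Ineq2138KLevelSkeletonV1
import Literature.MathematicalPhysics.QuantumFieldTheory.Balaban1983to89.B6Ineq2134RightFactorA
import Literature.MathematicalPhysics.QuantumFieldTheory.Balaban1983to89.B6LineOneENormSuppKLevelV1
import Literature.MathematicalPhysics.QuantumFieldTheory.Balaban1983to89.B6Line3CubeV1

/-!
# `Balaban1983to89.B6Ineq2134DivNormSuppKLevelV1` — T. Bałaban, *Propagators and renormalization transformations for lattice gauge theories. II*,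
# Commun. Math. Phys. **96** (1984) 223–250 [Balaban1984PropagatorsII], Prop. 2.6 (2.138) p. 247 via (2.134)/(2.141): THE LAST LEGS
# `K_{□,□′}G_{□′}h_{□′}∇*_ν` OF THE WALK FOR `∇G∇*` ON THE CENSUS HÖLDER CLASS, FOR THE GENUINE k-LEVEL FAMILY — and with them THE ENTRY (2.138)
# `|(∇G∇*J)(x)| ≤ O(1)e^{−δ₃d(y,y′)}(‖J‖_ε + |J|)` AT k LEVELS, HYPOTHESIS-FREE (census slot c3 of `…B6Prop26PrintedStage2KLevelV1.prop26Printed_kLevel_of_slots5`)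

statement-level skeleton of published theorems with citation tags; proofs where landed; nothing here is a claim about the Yang–Mills mass gap

WHAT IS PRINTED (p. 247 [PDF 25]): *"|(∇G∇*J)(x)| ≤ O(1)e^{−δ₃d(y,y′)}(‖J‖^{ξ′}_ε + |J|) (2.138) … |(K_{□,□′}G_{□′}h_{□′}J)(x)| ≤ O(M⁻¹)e^{−½δ₂d(y,y′)}|J| (2.134)
… The operator G can be represented as G = G₀(I − R)⁻¹ = Σ G₀Rⁿ = Σ_ω h_{□₀}G_{□₀}h_{□₀}K_{□₁,□₂}G_{□₂}h_{□₂}…K_{□_{2n−1},□_{2n}}G_{□_{2n}}h_{□_{2n}} (2.141) and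
the series above is convergent in the norms appearing in the inequalities (2.136)–(2.140)."*

CITATION HEADER (lean-in-tree rule) — WHAT IS REPRODUCED.  Cell `pub-ymgap`, seat `pub-ymgap-dag-n03-b` (FIRST-MISSING-ESTIMATE for DAG node N03 = [B6]; the
assembly (L3) of the (2.138) programme).  THIS FILE:
* §1 `hasMajorantA_T_of_TB` (frames); **`divLegs_kLevel`** — THE LEGS FAMILY: for the weight band `[b₀, b₁]` there is `σ_L > 0` such that for every
  `0 < σ ≤ σ_L` there is a threshold `M_L` and, for every `0 < ε < 1`, a constant `θ ≥ 0` (print's `O(M⁻¹)·O(1)`, the `M⁻¹` not displayed) with: on every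
  admissible V1 torus (`k ≥ 2`, `M_h = Lᵃ ≥ 8`, `R ≥ 2L²`, `P′ ≥ 5`, `L ≥ 5`, cubes placed, `L·M_h ≥ M_L`), for `c′ ≠ 0`, weights `w`, direction `ν` and
  every pair of cubes, `K_{□,□′}G_{□′}h_{□′}∇*_ν ≺_adm θ·(|c′|/L^{j(y′)})·e^{−σd_T(y,y′)}` on the census Hölder class «supp J ⊂ Δ(y′), ‖J‖_ε + |J| ≤ B» —
  `…B6Ineq2134RightFactorA.h2134A_kFam_torus` (the kernels (2.92)/(2.93) against an abstract right factor) INSTANTIATED at the rescaled genuine family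
  exactly as p22's `…B6Ineq2134KFamKLevelExportV1.h2134_kFam_kLevel_le` instantiates p38's family theorem (`c′²•G_□`, `c′⁻²•M_□, P_□, N_□, Δ−R`,
  `c′⁻²c_e, c′⁻²c₀`, `hdec_smul ∘ hdec_cube`, r03's member/global inputs `hNin/hNout/hPlin/hPlout_cube`, `hasMajorant_Dg_V1_TB`, p38's `abs_c0C_le`,
  `c0C_supp`, `abs_zC_le`, the partition binders, `line3_cube`, `gap_QT`, `kFam_smul` back), with the right factor `X_{□′} = h_{□′}∇*_ν`, the sup letter
  `hX` = `…B6DivLegNormSuppKLevelV1.hGhDVa_cube_normSupp` and the line-1 letters `hE` = `…B6LineOneENormSuppKLevelV1.lineOneE_hB_DVa_normSupp` (pub-ymgap dag-p1, p410499);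
* §2 **`ineq2138_kLevel_census`** — THE ENTRY (2.138) AT k LEVELS FOR THE GENUINE V1 OPERATOR, HYPOTHESIS-FREE: the census slot c3 of r03's
  `prop26Printed_kLevel_of_slots5` (`B6.Prop26Printed.e2138` for `kGeoG`/`kG`), by `…B6Ineq2138KLevelSkeletonV1.ineq2138_kLevel_census_of_legs` fed
  with §1.
IMPORTS BY NAME, restating nothing.  THEOREMS ONLY (no `def`, no `def … : Prop`, no new hypothesis-shaped fact); standard axioms.

HONEST SCOPE / DIVERGENCES.  (1) Input support = the census block `Δ(y′)` (print: `Δ̃(y′)`; GAPS G-B6-2138-SUPP, sub-case typed).  (2) `δ₃` and the thresholds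
depend on `d, L, b₀, b₁` only; the constant `C_ε → ∞` as `ε → 0` (as printed).  (3) `k ≥ 2`, `L ≥ 5`, `M_h = Lᵃ ≥ 8`, `R ≥ 2L²`, `P′ ≥ 5`, cubes placed (the
V1 family of the census index `KIdx`).  Integer torus, lattice units; nothing on d = 4 or the continuum; NOT a node discharge; NOT summit progress.  Unit
`pub-ymgap-dag-n03-b` (gen 0), 2026-08-25.
-/

open scoped BigOperators
open Finset

namespace Literature.MathematicalPhysics.QuantumFieldTheory.Balaban1983to89.B6Ineq2134DivNormSuppKLevelV1

open LatticeFieldCalculus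
open B6MultiLevelBoxOperator (N0)
open B6MultiLevelTorusOperator (TDomains)
open B6Cover236MultiLevelBlocks (cubes)
open B6Geom246MultiLevelTorus (geomT)
open B8Ineq192MultiLevelTorus (geomTB geomTB_len geomT_len geomTB_M)
open B6RandomWalk (HasMajorant hasMajorant_mono BlockSupp)
open B6RandomWalkInputNorm (HasMajorantA NormSupp hasMajorantA_mono hasMajorantA_smul)
open B6Prop26Gluing (mulOp)
open B6Eq291Generator (kFam)
open B6Ineq2133TwoScaleV1 (onFun)
open B6GlobalChartV1 (PV toBox domT blkV1)
open B6SectAOperatorsV1 (dE dsE dcE dcsE QE aE QsE RE BondIdx)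
open B6SectAVectorModelV1 (GE)
open B6Partition118KLevelTorusCentral (QT QbigT zetaT zetaT_nonneg zetaT_le_one not_mem_QbigT_of_zetaT_ne_one one_le_of_four_le)
open B6Partition118KLevelTorusBinders (sLipT sLipT_nonneg abs_hT_sub_le_distT gap_QT)
open B6Prop26KLevelSkeletonV1 (hB zB ST mem_ST pref pref_nonneg abs_hB_le_one blkV1_mem_QT_of_hB_ne_zero)
open B6Prop26KLevelSkeletonV2 (SbigT mem_SbigT kFam_smul)
open B6InMajorantTransplant (InMajorant inMajorant_mono inMajorant_smul InMajorant.localMajorant)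
open B6InDecayWindowV1 (OutMajorant outMajorant_mono outMajorant_smul)
open B6CubeWindowV1 (Placed Gl Ml Pl GlobalBand band_le one_le_of_eight_le four_le_of_five_le)
open B6CubeInDecayV1 (hNin_cube hNout_cube hPlin_cube hPlout_cube)
open B6Eq292MemberTorusV1 (EC cfC c0C NC zC hdec_cube abs_zC_le)
open B6Dg288ChartV1 (hasMajorant_Dg_V1_TB)
open B6Prop26KLevelAssemblyV1 (hasMajorant_smul hdec_smul sq_mul_pref inv_sq_mul_pref_inv lenTB_pos distT_nonneg mulOp_const_mul
  hasMajorant_T_of_TB inMajorant_TB localMajorant_TB outMajorant_TB)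
open B6CubeCoeffSizesV1 (abs_c0C_le c0C_supp s2C_nonneg)
open B6Partition118KLevelFineSecond (C2F C2F_nonneg)
open B6Line3CubeV1 (line3_cube)
open B6LapLegKLevelV1 (DVa)
open B6HolderNormV1 (holderV1 supNormV1)
open B6KLevelCensusIndexV1 (KIdx kGeoG)
open B6Prop26Census2136KLevelV1 (kG)
open B6Ineq2134RightFactorA (h2134A_kFam_torus)
open B6DivLegNormSuppKLevelV1 (hGhDVa_cube_normSupp)
open B6LineOneENormSuppKLevelV1 (lineOneE_hB_DVa_normSupp)
open B6Ineq2138KLevelSkeletonV1 (ineq2138_kLevel_census_of_legs)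

noncomputable section

variable {d ℓ : ℕ} {hd : 1 ≤ d + 1} {hL : Odd (ℓ + 1) ∧ 1 < ℓ + 1} {m K : ℕ} {Mh k R : ℕ} {P' : Fin (d + 1) → ℕ}

/-- rate weakening of an exponential kernel. [folklore] -/
private theorem exp_le_exp_of_rate {ρ σ t : ℝ} (h : σ ≤ ρ) (ht : 0 ≤ t) : Real.exp (-(ρ * t)) ≤ Real.exp (-(σ * t)) :=
  Real.exp_le_exp.mpr (neg_le_neg (mul_le_mul_of_nonneg_right h ht))

/-! ## §1  The legs family `K_{□,□′}G_{□′}h_{□′}∇*_ν` on the census Hölder class -/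

section Legs

/-- `geomTB D` and `geomT D` have the same sites, block map and distance: an input-class majorant transfers back. [cite: Balaban1984PropagatorsII, (2.45)–(2.46) p.231, dictionary] -/
theorem hasMajorantA_T_of_TB (hN : ∀ μ, N0 ℓ Mh k P' μ = (PV d ℓ m K hd hL).sitesPerDir 0) (D : TDomains d ℓ Mh k P' R)
    {adm : (PBond (PV d ℓ m K hd hL) 0 → ℝ) → (geomT D).Site → ℝ → Prop}
    {T : Module.End ℝ (PBond (PV d ℓ m K hd hL) 0 → ℝ)} {Kk : (geomT D).Site → (geomT D).Site → ℝ}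
    (h : HasMajorantA (g := geomTB D) (blkV1 hN D) adm T Kk) : HasMajorantA (g := geomT D) (blkV1 hN D) adm T Kk :=
  fun y' μ B hμ x => h y' μ B hμ x

/-- … and forth. [cite: Balaban1984PropagatorsII, (2.45)–(2.46) p.231, dictionary] -/
theorem hasMajorantA_TB (hN : ∀ μ, N0 ℓ Mh k P' μ = (PV d ℓ m K hd hL).sitesPerDir 0) (D : TDomains d ℓ Mh k P' R)
    {adm : (PBond (PV d ℓ m K hd hL) 0 → ℝ) → (geomT D).Site → ℝ → Prop}
    {T : Module.End ℝ (PBond (PV d ℓ m K hd hL) 0 → ℝ)} {Kk : (geomT D).Site → (geomT D).Site → ℝ}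
    (h : HasMajorantA (g := geomT D) (blkV1 hN D) adm T Kk) : HasMajorantA (g := geomTB D) (blkV1 hN D) adm T Kk :=
  fun y' μ B hμ x => h y' μ B hμ x

set_option maxHeartbeats 400000 in
open Classical in
/-- **THE LAST LEGS `K_{□,□′}G_{□′}h_{□′}∇*_ν` OF (2.141) FOR `∇G∇*`, GENUINE k-LEVEL FAMILY, ON THE CENSUS HÖLDER CLASS.**  For the weight band `[b₀, b₁]`
there is `σ_L > 0` such that for every `0 < σ ≤ σ_L` there is `M_L` and, for every `0 < ε < 1`, `θ ≥ 0` with: on every admissible V1 torus (`k ≥ 2`,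
`M_h = Lᵃ ≥ 8`, `R ≥ 2L²`, `P′ ≥ 5`, `L ≥ 5`, cubes placed, `M_L ≤ L·M_h`), for `c′ ≠ 0`, weights `w`, direction `ν` and cubes `□, □′`:
`K_{□,□′}G_{□′}h_{□′}∇*_ν ≺_adm θ·(|c′|/L^{j(y′)})·e^{−σd_T(y,y′)}` on «supp J ⊂ Δ(y′), ‖J‖_ε + |J| ≤ B» — (2.134) `O(M⁻¹)e^{−½δ₂d}` composed with the member
(1.110)₃/(1.112) behind `h_{□′}∇*_ν`, in the (2.138) norm; exactly the hypothesis `hlegs` of `…B6Ineq2138KLevelSkeletonV1.ineq2138_kLevel_census_of_legs`.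
[cite: Balaban1984PropagatorsII, Prop. 2.6 (2.138) p.247, (2.134) p.247, (2.141) p.247, (2.92)–(2.94) p.239, (2.133) p.247, (2.88) p.238; Balaban1984PropagatorsI, (1.110)/(1.112) p.35–36] -/
theorem divLegs_kLevel (d ℓ : ℕ) (hd : 1 ≤ d + 1) (hL : Odd (ℓ + 1) ∧ 1 < ℓ + 1) {b₀ b₁ : ℝ} (hb₀ : 0 < b₀) (hb₁ : b₀ ≤ b₁) :
    ∃ σL : ℝ, 0 < σL ∧ ∀ σ : ℝ, 0 < σ → σ ≤ σL → ∃ ML : ℝ, ∀ ε : ℝ, 0 < ε → ε < 1 → ∃ θ : ℝ, 0 ≤ θ ∧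
      ∀ (m K : ℕ) {Mh k R : ℕ} {P' : Fin (d + 1) → ℕ}
        (hN : ∀ μ, N0 ℓ Mh k P' μ = (PV d ℓ m K hd hL).sitesPerDir 0) (D : TDomains d ℓ Mh k P' R) (hk : k ≤ m + K) (_ : 2 ≤ k)
        {a : ℕ} (hMha : Mh = (ℓ + 1) ^ a) (hM8 : 8 ≤ Mh) (_ : 2 * (ℓ + 1) ^ 2 ≤ R) (hP5 : ∀ μ, 5 ≤ P' μ) (_ : 4 ≤ ℓ)
        (hpl : ∀ c : ↥(cubes D.toDomains), Placed ℓ k P' c.1) (_ : ML ≤ ((ℓ : ℝ) + 1) * Mh)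
        {cf : ℝ} (_ : cf ≠ 0) {w : BondIdx (domT hN D hk) → ℝ} (_ : ∀ i, 0 < w i) (_ : GlobalBand b₀ b₁ cf w)
        (ν : Fin (d + 1)) (c c' : ↥(cubes D.toDomains)),
        HasMajorantA (g := geomT D) (blkV1 hN D)
          (NormSupp (g := geomT D) (blkV1 hN D) (fun y' => ({y'} : Set (geomT D).Site)) (fun _ J => holderV1 hN D ε J + supNormV1 J))
          (kFam (onFun (dE (P := PV d ℓ m K hd hL) cf ∘ₗ (LinearMap.id - RE (domT hN D hk) cf) ∘ₗ dsE cf))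
              (fun c => mulOp (hB hN D c)) (fun c => mulOp (zB hN D (one_le_of_eight_le hM8) (four_le_of_five_le hP5) c))
              (fun c => Ml hN hk (one_le_of_eight_le hM8) (four_le_of_five_le hP5) hMha c (band_le (d := d) (ℓ := ℓ) hb₀ hb₁) (hpl c) w cf)
              (fun c => Pl hN hk (one_le_of_eight_le hM8) (four_le_of_five_le hP5) hMha c (band_le (d := d) (ℓ := ℓ) hb₀ hb₁) (hpl c) w cf) c c' *
            Gl hN hk (one_le_of_eight_le hM8) (four_le_of_five_le hP5) hMha c' (band_le (d := d) (ℓ := ℓ) hb₀ hb₁) (hpl c') w cf *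
            mulOp (hB hN D c') * DVa (P := PV d ℓ m K hd hL) ν cf)
          (fun y y' => θ * (|cf| / (geomT D).len y') * Real.exp (-(σ * (geomT D).dist y y'))) := by
  -- ### constants of the member / global inputs (all on `d, L, b₀, b₁` only)
  have ha₀ : (0 : ℝ) < b₀ / ((ℓ + 1 : ℕ) : ℝ) := by positivity
  obtain ⟨ρX, hρX, CX, hCX, hX⟩ := hGhDVa_cube_normSupp d ℓ hd hL ha₀ (band_le (d := d) (ℓ := ℓ) hb₀ hb₁)
  obtain ⟨ρL, hρL, HE⟩ := lineOneE_hB_DVa_normSupp d ℓ hd hL ha₀ (band_le (d := d) (ℓ := ℓ) hb₀ hb₁)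
  obtain ⟨ρN, hρN, CN, hCN, hNin⟩ := hNin_cube d ℓ hd hL ha₀ (band_le (d := d) (ℓ := ℓ) hb₀ hb₁)
  obtain ⟨ρN', hρN', CN', hCN', hNout⟩ := hNout_cube d ℓ hd hL ha₀ (band_le (d := d) (ℓ := ℓ) hb₀ hb₁)
  obtain ⟨ρP, hρP, CP, hCP, hPlin⟩ := hPlin_cube d ℓ hd hL ha₀ (band_le (d := d) (ℓ := ℓ) hb₀ hb₁)
  obtain ⟨ρP', hρP', CP', hCP', hPlout⟩ := hPlout_cube d ℓ hd hL ha₀ (band_le (d := d) (ℓ := ℓ) hb₀ hb₁)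
  obtain ⟨M₃, δ₂, C₂, hM₃, hδ₂, hC₂, hDg⟩ := hasMajorant_Dg_V1_TB d ℓ hd hL
  obtain ⟨ρ₃, CD, cD, M₄, hρ₃, hCD, hcD, hcube⟩ := line3_cube d ℓ hd hL hb₀ hb₁
  obtain ⟨ρ, hρ, hρX', hρL', hρN1, hρN2, hρP1, hρP2, hρD, hρ3⟩ :
      ∃ ρ : ℝ, 0 < ρ ∧ ρ ≤ ρX ∧ ρ ≤ ρL ∧ ρ ≤ ρN ∧ ρ ≤ ρN' ∧ ρ ≤ ρP ∧ ρ ≤ ρP' ∧ ρ ≤ δ₂ ∧ ρ ≤ ρ₃ := by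
    refine ⟨min (min (min ρX ρL) (min ρN ρN')) (min (min ρP ρP') (min δ₂ ρ₃)),
      lt_min (lt_min (lt_min hρX hρL) (lt_min hρN hρN')) (lt_min (lt_min hρP hρP') (lt_min hδ₂ hρ₃)), ?_, ?_, ?_, ?_, ?_, ?_, ?_, ?_⟩
    · exact (min_le_left _ _).trans ((min_le_left _ _).trans (min_le_left _ _))
    · exact (min_le_left _ _).trans ((min_le_left _ _).trans (min_le_right _ _))
    · exact (min_le_left _ _).trans ((min_le_right _ _).trans (min_le_left _ _))
    · exact (min_le_left _ _).trans ((min_le_right _ _).trans (min_le_right _ _))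
    · exact (min_le_right _ _).trans ((min_le_left _ _).trans (min_le_left _ _))
    · exact (min_le_right _ _).trans ((min_le_left _ _).trans (min_le_right _ _))
    · exact (min_le_right _ _).trans ((min_le_right _ _).trans (min_le_left _ _))
    · exact (min_le_right _ _).trans ((min_le_right _ _).trans (min_le_right _ _))
  refine ⟨ρ / 2, by positivity, ?_⟩
  intro σ hσ0 hσle
  have h2σ : 2 * σ ≤ ρ := by linarith
  have h2σ0 : 0 < 2 * σ := by positivity
  obtain ⟨CNN, hCNN0, hCN1, hCN2, hCP1, hCP2⟩ : ∃ CNN : ℝ, 0 ≤ CNN ∧ CN ≤ CNN ∧ CN' ≤ CNN ∧ CP ≤ CNN ∧ CP' ≤ CNN :=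
    ⟨max (max CN CN') (max CP CP'), le_max_of_le_left (le_max_of_le_left hCN), le_max_of_le_left (le_max_left _ _),
      le_max_of_le_left (le_max_right _ _), le_max_of_le_right (le_max_left _ _), le_max_of_le_right (le_max_right _ _)⟩
  -- the generic threshold (all constants `c′`-free and `ε`-free)
  obtain ⟨M₀, Θ, hM₀, hΘ, h38⟩ := h2134A_kFam_torus d ℓ h2σ0
  refine ⟨max M₀ (max M₃ M₄), fun ε hε0 hε1 => ?_⟩
  obtain ⟨CEε, hCEε, hEε⟩ := HE ε hε0 hε1
  -- the constant: `Θ·(C_P C_X/m + U)` with the line-1 letters at `θ_E = C_ε`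
  set U : ℝ := (Fintype.card (Fin (d + 1) × Bool) : ℕ) * CEε + (((d : ℝ) + 1) * C2F d ℓ * ((ℓ : ℝ) + 1)) * CX + ((1 : ℕ) + 1) * sLipT d ℓ * ((CNN + 1) * CX * (1 + 1)) + CD * CX / cD
    with hU
  have hs := sLipT_nonneg d ℓ
  have hs2 := s2C_nonneg d ℓ
  have hUnn : 0 ≤ U := by rw [hU]; positivity
  have hm0 : (0 : ℝ) < 1 / (2 * ((ℓ : ℝ) + 1) ^ 2) := by positivity
  refine ⟨Θ * (((d : ℝ) + 1) * C₂ * CX / (1 / (2 * ((ℓ : ℝ) + 1) ^ 2)) + U), by positivity, ?_⟩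
  intro m K Mh k R P' hN D hk hk2 a hMha hM8 hR2 hP5 hℓ hpl hM₁' cf hcf w hw hband ν c c'
  -- ### the torus
  have hMh1 : 1 ≤ Mh := one_le_of_eight_le hM8
  have hP4 : ∀ μ, 4 ≤ P' μ := four_le_of_five_le hP5
  have hP : ∀ μ, 1 ≤ P' μ := one_le_of_four_le hP4
  have hMh : 2 ≤ Mh := le_trans (by norm_num) hM8
  have hR : 2 * (ℓ + 1) ≤ R := le_trans (by nlinarith : 2 * (ℓ + 1) ≤ 2 * (ℓ + 1) ^ 2) hR2
  have hℓ1 : 1 ≤ ℓ := le_trans (by norm_num) hℓ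
  have hLM : M₀ ≤ ((ℓ : ℝ) + 1) * Mh := le_trans (le_max_left _ _) hM₁'
  have hLM₃ : M₃ ≤ ((ℓ : ℝ) + 1) * Mh := le_trans ((le_max_left _ _).trans (le_max_right _ _)) hM₁'
  have hLM₄ : M₄ ≤ ((ℓ : ℝ) + 1) * Mh := le_trans ((le_max_right _ _).trans (le_max_right _ _)) hM₁'
  have hcf2 : cf ^ 2 ≠ 0 := pow_ne_zero 2 hcf
  have hcf2pos : 0 < cf ^ 2 := by positivity
  have habs2 : |cf ^ 2| = cf ^ 2 := abs_of_pos hcf2pos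
  have habs2i : |(cf ^ 2)⁻¹| = (cf ^ 2)⁻¹ := abs_of_pos (inv_pos.2 hcf2pos)
  have hMpos : 0 < (geomTB D).M := by rw [geomTB_M]; positivity
  have hdnn : ∀ y y' : (geomT D).Site, 0 ≤ (geomT D).dist y y' := distT_nonneg
  have hlenT : ∀ y : (geomT D).Site, (geomTB D).len y = (geomT D).len y := fun y => by rw [geomTB_len, geomT_len]
  have hlen0 : ∀ y : (geomT D).Site, 0 < (geomT D).len y := fun y => by rw [← hlenT]; exact lenTB_pos y
  have hQ0 : ∀ y : (geomT D).Site, 0 ≤ |cf| / (geomT D).len y := fun y => div_nonneg (abs_nonneg _) (hlen0 y).le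
  have hadm : ∀ (J : PBond (PV d ℓ m K hd hL) 0 → ℝ) (y' : (geomT D).Site) (B : ℝ),
      NormSupp (g := geomT D) (blkV1 hN D) (fun y' => ({y'} : Set (geomT D).Site)) (fun _ J => holderV1 hN D ε J + supNormV1 J) J y' B → 0 ≤ B :=
    fun _ _ _ h => h.nonneg
  -- ### the global operator, rescaled
  have hDg' : HasMajorant (g := geomTB D) (blkV1 hN D)
      ((cf ^ 2)⁻¹ • onFun (dE (P := PV d ℓ m K hd hL) cf ∘ₗ (LinearMap.id - RE (domT hN D hk) cf) ∘ₗ dsE cf))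
      (fun y y'' => ((d : ℝ) + 1) * C₂ / (geomTB D).len y ^ 2 * Real.exp (-((2 * σ) * (geomTB D).dist y y''))) := by
    refine hasMajorant_mono _ (hasMajorant_smul _ (hDg m K hN D hk hMh1 hP4 hR hLM₃ hcf) _) fun y y'' => ?_
    rw [habs2i]
    have hl := lenTB_pos (D := D) y
    calc (cf ^ 2)⁻¹ * (cf ^ 2 * ((d : ℝ) + 1) * C₂ / (geomTB D).len y ^ 2 * Real.exp (-(δ₂ * (geomTB D).dist y y'')))
        = ((d : ℝ) + 1) * C₂ / (geomTB D).len y ^ 2 * Real.exp (-(δ₂ * (geomTB D).dist y y'')) := by field_simp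
      _ ≤ ((d : ℝ) + 1) * C₂ / (geomTB D).len y ^ 2 * Real.exp (-((2 * σ) * (geomTB D).dist y y'')) :=
          mul_le_mul_of_nonneg_left (exp_le_exp_of_rate (h2σ.trans hρD) (hdnn y y'')) (by positivity)
  -- ### the generic theorem at the rescaled genuine family with the right factor `h_{□′}∇*_ν`
  have H := h38 D hMh1 hP hR hLM (blkV1 hN D) hadm (Q := fun y' => |cf| / (geomT D).len y') hQ0
    (CP := ((d : ℝ) + 1) * C₂) (by positivity) hDg'
    (CG := CX) (CN := CNN) (CD := CD) (cD := cD) (s := sLipT d ℓ) (s₂ := (((d : ℝ) + 1) * C2F d ℓ * ((ℓ : ℝ) + 1))) (θE := CEε) (r₀ := 1) (m := 1 / (2 * ((ℓ : ℝ) + 1) ^ 2))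
    hCX hCNN0 hCD hcD hs hs2 hCEε zero_le_one hm0 (Fintype.card (Fin (d + 1) × Bool)) 1 (Finset.univ : Finset ↥(cubes D.toDomains))
    (G := fun c => cf ^ 2 • Gl hN hk hMh1 hP4 hMha c (band_le (d := d) (ℓ := ℓ) hb₀ hb₁) (hpl c) w cf)
    (Ml := fun c => (cf ^ 2)⁻¹ • Ml hN hk hMh1 hP4 hMha c (band_le (d := d) (ℓ := ℓ) hb₀ hb₁) (hpl c) w cf)
    (Pl := fun c => (cf ^ 2)⁻¹ • Pl hN hk hMh1 hP4 hMha c (band_le (d := d) (ℓ := ℓ) hb₀ hb₁) (hpl c) w cf)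
    (XR' := fun c => mulOp (hB hN D c) * DVa (P := PV d ℓ m K hd hL) ν cf)
    (h := fun c => hB hN D c) (ζ := fun c => zB hN D hMh1 hP4 c)
    (c₀ := fun c x => (cf ^ 2)⁻¹ * c0C hN hk hMh1 hP4 hMha c (band_le (d := d) (ℓ := ℓ) hb₀ hb₁) (hpl c) w cf x)
    (T := fun c => ST D hMh1 hP4 c) (S := fun c => ST D hMh1 hP4 c) (Score := fun c => SbigT D hMh1 hP4 c)
    (DE := fun _ => (Finset.univ : Finset (Fin (d + 1) × Bool)))
    (E := fun c e => EC hN hk hMh1 hP4 hMha c (band_le (d := d) (ℓ := ℓ) hb₀ hb₁) (hpl c) w cf e)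
    (cf := fun c e x => (cf ^ 2)⁻¹ * cfC hN hk hMh1 hP4 hMha c (band_le (d := d) (ℓ := ℓ) hb₀ hb₁) (hpl c) w cf e x)
    (DK := fun _ => ({()} : Finset Unit))
    (N := fun c _ => (cf ^ 2)⁻¹ • NC hN hk hMh1 hP4 hMha c (band_le (d := d) (ℓ := ℓ) hb₀ hb₁) (hpl c) w cf)
    (z := fun c _ => zC hN hk hMh1 hP4 hMha c (band_le (d := d) (ℓ := ℓ) hb₀ hb₁) (hpl c) w cf)
    -- hnE, hnK
    (fun c _ => le_of_eq Finset.card_univ) (fun c _ => by simp)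
    -- hdec
    (fun c _ => hdec_smul Finset.univ ({()} : Finset Unit)
      (N := fun _ => NC hN hk hMh1 hP4 hMha c (band_le (d := d) (ℓ := ℓ) hb₀ hb₁) (hpl c) w cf)
      (z := fun _ => zC hN hk hMh1 hP4 hMha c (band_le (d := d) (ℓ := ℓ) hb₀ hb₁) (hpl c) w cf)
      (hdec_cube hN hk hMh1 hP4 hMha c (band_le (d := d) (ℓ := ℓ) hb₀ hb₁) hM8 hR2 (hpl c) w cf) _)
    -- hE: the line-1 letters (this programme's (L2b)), rescaling undone, rate weakened
    (fun c _ e _ => by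
      have hx := hEε m K hN D hk hMh1 hP4 hMha hM8 hR2 hP5 hℓ c (hpl c) w hcf ν e
      have eop : mulOp (fun x => (cf ^ 2)⁻¹ * cfC hN hk hMh1 hP4 hMha c (band_le (d := d) (ℓ := ℓ) hb₀ hb₁) (hpl c) w cf e x) *
            EC hN hk hMh1 hP4 hMha c (band_le (d := d) (ℓ := ℓ) hb₀ hb₁) (hpl c) w cf e *
            (cf ^ 2 • Gl hN hk hMh1 hP4 hMha c (band_le (d := d) (ℓ := ℓ) hb₀ hb₁) (hpl c) w cf *
              (mulOp (hB hN D c) * DVa (P := PV d ℓ m K hd hL) ν cf)) =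
          mulOp (cfC hN hk hMh1 hP4 hMha c (band_le (d := d) (ℓ := ℓ) hb₀ hb₁) (hpl c) w cf e) *
            EC hN hk hMh1 hP4 hMha c (band_le (d := d) (ℓ := ℓ) hb₀ hb₁) (hpl c) w cf e *
            (Gl hN hk hMh1 hP4 hMha c (band_le (d := d) (ℓ := ℓ) hb₀ hb₁) (hpl c) w cf *
              (mulOp (hB hN D c) * DVa (P := PV d ℓ m K hd hL) ν cf)) := by
        rw [mulOp_const_mul, smul_mul_assoc, smul_mul_assoc, smul_mul_assoc, mul_smul_comm, smul_smul, inv_mul_cancel₀ hcf2, one_smul]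
      rw [eop]
      refine hasMajorantA_TB hN D (hasMajorantA_mono (g := geomT D) (blkV1 hN D) hx hadm fun y y' => ?_)
      rw [geomTB_M]
      exact mul_le_mul_of_nonneg_right (mul_le_mul_of_nonneg_left (exp_le_exp_of_rate (h2σ.trans hρL') (hdnn y y')) (by positivity)) (hQ0 y'))
    -- hc₀, hc₀T
    (fun c _ x => by
      have hl := lenTB_pos (D := D) (blkV1 hN D x)
      rw [abs_mul, habs2i]
      calc (cf ^ 2)⁻¹ * |c0C hN hk hMh1 hP4 hMha c (band_le (d := d) (ℓ := ℓ) hb₀ hb₁) (hpl c) w cf x|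
          ≤ (cf ^ 2)⁻¹ * ((((d : ℝ) + 1) * C2F d ℓ * ((ℓ : ℝ) + 1)) * cf ^ 2 / ((geomTB D).M * (geomTB D).len (blkV1 hN D x) ^ 2)) :=
            mul_le_mul_of_nonneg_left (abs_c0C_le hN hk hMh1 hP4 hMha c (band_le (d := d) (ℓ := ℓ) hb₀ hb₁) hM8 hR2 hP5 (hpl c) w cf x)
              (by positivity)
        _ = (((d : ℝ) + 1) * C2F d ℓ * ((ℓ : ℝ) + 1)) / ((geomTB D).M * (geomTB D).len (blkV1 hN D x) ^ 2) := by field_simp)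
    -- hh1, hhS, hST, hLip
    (fun c _ x => abs_hB_le_one hN D hMh1 hP c x)
    (fun c _ x hx => blkV1_mem_QT_of_hB_ne_zero hN D hMh hR hP4 c hx)
    (fun c _ => fun _ hy => hy)
    (fun c _ x x' => abs_hT_sub_le_distT hℓ1 hMh hR hP5 c (toBox hN x.src) (toBox hN x'.src))
    -- hNin, hNout
    (fun c _ k _ => by
      refine inMajorant_TB hN (inMajorant_mono (g := geomT D) _ (inMajorant_smul _ (hNin m K hN D hk hMh1 hP4 hMha hMh hR2 hℓ c (hpl c) w cf) ((cf ^ 2)⁻¹))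
        (K' := fun (y y'' : (geomT D).Site) => CNN / (geomTB D).len y ^ 2 * Real.exp (-((2 * σ) * (geomT D).dist y y''))) fun y y'' _ => ?_)
      rw [habs2i]
      have hl := lenTB_pos (D := D) y
      calc (cf ^ 2)⁻¹ * (CN * (pref cf y)⁻¹ * Real.exp (-(ρN * (geomT D).dist y y'')))
          = CN * ((cf ^ 2)⁻¹ * (pref cf y)⁻¹) * Real.exp (-(ρN * (geomT D).dist y y'')) := by ring
        _ = CN / (geomTB D).len y ^ 2 * Real.exp (-(ρN * (geomT D).dist y y'')) := by rw [inv_sq_mul_pref_inv cf hcf y]; ring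
        _ ≤ CNN / (geomTB D).len y ^ 2 * Real.exp (-((2 * σ) * (geomT D).dist y y'')) :=
            mul_le_mul (div_le_div_of_nonneg_right hCN1 (by positivity)) (exp_le_exp_of_rate (h2σ.trans hρN1) (hdnn y y''))
              (Real.exp_nonneg _) (by positivity))
    (fun c _ k _ => by
      have hx := outMajorant_mono (g := geomT D) _ (outMajorant_smul _ (hNout m K hN D hk hMh1 hP4 hMha hMh hR2 hℓ c (hpl c) w cf) ((cf ^ 2)⁻¹))
        (K' := fun (y y'' : (geomT D).Site) => CNN / (geomTB D).len y ^ 2 * Real.exp (-((2 * σ) * (geomT D).dist y y''))) fun y _ y'' => by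
          rw [habs2i]
          have hl := lenTB_pos (D := D) y
          calc (cf ^ 2)⁻¹ * (CN' * (pref cf y)⁻¹ * Real.exp (-(ρN' * (geomT D).dist y y'')))
              = CN' * ((cf ^ 2)⁻¹ * (pref cf y)⁻¹) * Real.exp (-(ρN' * (geomT D).dist y y'')) := by ring
            _ = CN' / (geomTB D).len y ^ 2 * Real.exp (-(ρN' * (geomT D).dist y y'')) := by rw [inv_sq_mul_pref_inv cf hcf y]; ring
            _ ≤ CNN / (geomTB D).len y ^ 2 * Real.exp (-((2 * σ) * (geomT D).dist y y'')) :=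
                mul_le_mul (div_le_div_of_nonneg_right hCN2 (by positivity)) (exp_le_exp_of_rate (h2σ.trans hρN2) (hdnn y y''))
                  (Real.exp_nonneg _) (by positivity)
      exact outMajorant_TB hN hx)
    -- hz
    (fun c _ k _ x => abs_zC_le hN hk hMh1 hP4 hMha c (band_le (d := d) (ℓ := ℓ) hb₀ hb₁) (hpl c) w cf x)
    -- hPlin, hPlout
    (fun c _ => by
      refine inMajorant_TB hN (inMajorant_mono (g := geomT D) _ (inMajorant_smul _ (hPlin m K hN D hk hMh1 hP4 hMha hMh hR2 hℓ c (hpl c) w cf) ((cf ^ 2)⁻¹))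
        (K' := fun (y y'' : (geomT D).Site) => CNN / (geomTB D).len y ^ 2 * Real.exp (-((2 * σ) * (geomT D).dist y y''))) fun y y'' _ => ?_)
      rw [habs2i]
      have hl := lenTB_pos (D := D) y
      calc (cf ^ 2)⁻¹ * (CP * (pref cf y)⁻¹ * Real.exp (-(ρP * (geomT D).dist y y'')))
          = CP * ((cf ^ 2)⁻¹ * (pref cf y)⁻¹) * Real.exp (-(ρP * (geomT D).dist y y'')) := by ring
        _ = CP / (geomTB D).len y ^ 2 * Real.exp (-(ρP * (geomT D).dist y y'')) := by rw [inv_sq_mul_pref_inv cf hcf y]; ring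
        _ ≤ CNN / (geomTB D).len y ^ 2 * Real.exp (-((2 * σ) * (geomT D).dist y y'')) :=
            mul_le_mul (div_le_div_of_nonneg_right hCP1 (by positivity)) (exp_le_exp_of_rate (h2σ.trans hρP1) (hdnn y y''))
              (Real.exp_nonneg _) (by positivity))
    (fun c _ => by
      have hx := outMajorant_mono (g := geomT D) _ (outMajorant_smul _ (hPlout m K hN D hk hMh1 hP4 hMha hMh hR2 hℓ c (hpl c) w cf) ((cf ^ 2)⁻¹))
        (K' := fun (y y'' : (geomT D).Site) => CNN / (geomTB D).len y ^ 2 * Real.exp (-((2 * σ) * (geomT D).dist y y''))) fun y _ y'' => by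
          rw [habs2i]
          have hl := lenTB_pos (D := D) y
          calc (cf ^ 2)⁻¹ * (CP' * (pref cf y)⁻¹ * Real.exp (-(ρP' * (geomT D).dist y y'')))
              = CP' * ((cf ^ 2)⁻¹ * (pref cf y)⁻¹) * Real.exp (-(ρP' * (geomT D).dist y y'')) := by ring
            _ = CP' / (geomTB D).len y ^ 2 * Real.exp (-(ρP' * (geomT D).dist y y'')) := by rw [inv_sq_mul_pref_inv cf hcf y]; ring
            _ ≤ CNN / (geomTB D).len y ^ 2 * Real.exp (-((2 * σ) * (geomT D).dist y y'')) :=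
                mul_le_mul (div_le_div_of_nonneg_right hCP2 (by positivity)) (exp_le_exp_of_rate (h2σ.trans hρP2) (hdnn y y''))
                  (Real.exp_nonneg _) (by positivity)
      exact outMajorant_TB hN hx)
    -- hζ0, hζ1, hζS
    (fun c _ x => zetaT_nonneg hMh1 hP4 c (toBox hN x.src)) (fun c _ x => zetaT_le_one hMh1 hP4 c (toBox hN x.src))
    (fun c _ x hx => not_mem_QbigT_of_zetaT_ne_one hMh1 hP4 c hx)
    -- hD3 (p38's line 3, rescaled, rate weakened)
    (fun c _ => by
      have hx := hasMajorant_smul _ (hcube m K hN D hk hk2 hMha hM8 hR2 hP5 hℓ hpl hLM₄ hcf w c) ((cf ^ 2)⁻¹)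
      have eop : (cf ^ 2)⁻¹ • (mulOp (zB hN D hMh1 hP4 c) *
            (onFun (dE (P := PV d ℓ m K hd hL) cf ∘ₗ (LinearMap.id - RE (domT hN D hk) cf) ∘ₗ dsE cf) -
              Pl hN hk hMh1 hP4 hMha c (band_le (d := d) (ℓ := ℓ) hb₀ hb₁) (hpl c) w cf) * mulOp (hB hN D c)) =
          mulOp (zB hN D hMh1 hP4 c) *
            ((cf ^ 2)⁻¹ • onFun (dE (P := PV d ℓ m K hd hL) cf ∘ₗ (LinearMap.id - RE (domT hN D hk) cf) ∘ₗ dsE cf) -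
              (cf ^ 2)⁻¹ • Pl hN hk hMh1 hP4 hMha c (band_le (d := d) (ℓ := ℓ) hb₀ hb₁) (hpl c) w cf) * mulOp (hB hN D c) := by
        simp only [smul_sub, mul_sub, sub_mul, mul_smul_comm, smul_mul_assoc]
      rw [eop] at hx
      refine hasMajorant_mono _ hx fun y y'' => ?_
      rw [habs2i]
      have hl := lenTB_pos (D := D) y
      have hd0 : 0 ≤ (geomTB D).dist y y'' := Nat.cast_nonneg _
      calc (cf ^ 2)⁻¹ * (CD * cf ^ 2 * Real.exp (-(cD * (geomTB D).M)) / (geomTB D).len y ^ 2 * Real.exp (-(ρ₃ * (geomTB D).dist y y'')))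
          = CD * Real.exp (-(cD * (geomTB D).M)) / (geomTB D).len y ^ 2 * Real.exp (-(ρ₃ * (geomTB D).dist y y'')) := by field_simp
        _ ≤ CD * Real.exp (-(cD * (geomTB D).M)) / (geomTB D).len y ^ 2 * Real.exp (-((2 * σ) * (geomTB D).dist y y'')) :=
            mul_le_mul_of_nonneg_left (exp_le_exp_of_rate (h2σ.trans hρ3) hd0) (by positivity))
    -- hgap
    (fun c _ y y'' hy hy'' => gap_QT hℓ1 hMh hR hP5 c hy hy'')
    -- hX: the sup letter of the right factor (this programme's (L2a)), rate weakened
    (fun c _ => by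
      have hx := hX m K hN D hk hMh1 hP4 hMha hM8 hR2 hP5 hℓ c (hpl c) w hcf ν ε
      rw [smul_mul_assoc, ← mul_assoc]
      refine hasMajorantA_TB hN D (hasMajorantA_mono (g := geomT D) (blkV1 hN D) hx hadm fun y y' => ?_)
      exact mul_le_mul_of_nonneg_right (mul_le_mul_of_nonneg_left (exp_le_exp_of_rate (h2σ.trans hρX') (hdnn y y')) (by positivity)) (hQ0 y'))
    c (Finset.mem_univ _) c' (Finset.mem_univ _)
  -- ### back to the TRUE family `K(rescaled)·(c′²G_□) = K·G_□`, the rate `2σ/2 = σ`, `M⁻¹ ≤ 1`, and out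
  rw [kFam_smul, smul_mul_smul_comm, inv_mul_cancel₀ hcf2, one_smul, ← mul_assoc] at H
  refine hasMajorantA_T_of_TB hN D (hasMajorantA_mono (g := geomTB D) (blkV1 hN D) H hadm fun y y' => ?_)
  have hMinv : ((geomTB D).M)⁻¹ ≤ 1 := by
    rw [geomTB_M]
    have : (1 : ℝ) ≤ ((ℓ : ℝ) + 1) * Mh := by
      have h1 : (1 : ℝ) ≤ (ℓ : ℝ) + 1 := by linarith [(Nat.cast_nonneg ℓ : (0 : ℝ) ≤ ℓ)]
      have h2 : (1 : ℝ) ≤ Mh := by exact_mod_cast hMh1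
      nlinarith
    exact inv_le_one_of_one_le₀ this
  have hK0 : 0 ≤ Θ * (((d : ℝ) + 1) * C₂ * CX / (1 / (2 * ((ℓ : ℝ) + 1) ^ 2)) + U) := by positivity
  have e2 : Real.exp (-(2 * σ / 2 * (geomTB D).dist y y')) = Real.exp (-(σ * (geomT D).dist y y')) := by
    rw [show 2 * σ / 2 = σ by ring]; rfl
  rw [e2]
  have hQ := hQ0 y'
  have he := Real.exp_nonneg (-(σ * (geomT D).dist y y'))
  calc Θ * (((d : ℝ) + 1) * C₂ * CX / (1 / (2 * ((ℓ : ℝ) + 1) ^ 2)) + U) * ((geomTB D).M)⁻¹ * Real.exp (-(σ * (geomT D).dist y y')) *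
        (|cf| / (geomT D).len y')
      ≤ Θ * (((d : ℝ) + 1) * C₂ * CX / (1 / (2 * ((ℓ : ℝ) + 1) ^ 2)) + U) * 1 * Real.exp (-(σ * (geomT D).dist y y')) *
        (|cf| / (geomT D).len y') :=
        mul_le_mul_of_nonneg_right (mul_le_mul_of_nonneg_right (mul_le_mul_of_nonneg_left hMinv hK0) he) hQ
    _ = Θ * (((d : ℝ) + 1) * C₂ * CX / (1 / (2 * ((ℓ : ℝ) + 1) ^ 2)) + U) * (|cf| / (geomT D).len y') *
        Real.exp (-(σ * (geomT D).dist y y')) := by ring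

end Legs

/-! ## §2  The entry (2.138) at k levels, hypothesis-free -/

section Entry

variable {b₀ b₁ : ℝ}

/-- **(2.138) AT k LEVELS FOR THE GENUINE V1 OPERATOR — HYPOTHESIS-FREE** (the census slot c3 of r03's `prop26Printed_kLevel_of_slots5`, i.e.
`B6.Prop26Printed.e4` for `kGeoG`/`kG`): there are `M₁, δ₃ > 0` and `ε ↦ C_ε` (on `d, L, b₀, b₁`) such that for every torus of the census index with
`L·M_h ≥ M₁`, every `0 < ε < 1`, every `J` supported in the census block `Δ(y′)` and every block `y`:
`sup_{x ∈ y} max_{μ,ν} |(∇_μG∇*_νJ)(x)| ≤ C_ε·e^{−δ₃d(y,y′)}·(‖J‖_ε + |J|)` — the walk (2.141) in the Hölder norm (`ineq2138_kLevel_census_of_legs`) fed with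
the legs family `divLegs_kLevel`.
[cite: Balaban1984PropagatorsII, Prop. 2.6 (2.138) p.247, (2.141) p.247, (2.134) p.247; Balaban1984PropagatorsI, Prop. 1.2 (1.112) p.36] -/
theorem ineq2138_kLevel_census (d ℓ : ℕ) (hd : 1 ≤ d + 1) (hL : Odd (ℓ + 1) ∧ 1 < ℓ + 1) (hb₀ : 0 < b₀) (hb₁ : b₀ ≤ b₁) :
    ∃ M₁ δ₃ : ℝ, ∃ Cε : ℝ → ℝ, 0 < M₁ ∧ 0 < δ₃ ∧ ∀ i : KIdx d ℓ hd hL b₀ b₁, M₁ ≤ (kGeoG i).M →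
      ∀ (ε : ℝ) (J : (kGeoG i).Loc) (y y' : (kGeoG i).Site), 0 < ε → ε < 1 → (kGeoG i).suppIn J y' →
        (kG i).e4 J y ≤ Cε ε * Real.exp (-(δ₃ * (kGeoG i).dist y y')) * ((kGeoG i).holder ε J + (kGeoG i).supNorm J) :=
  ineq2138_kLevel_census_of_legs d ℓ hd hL hb₀ hb₁ (divLegs_kLevel d ℓ hd hL hb₀ hb₁)

end Entry

end

end Literature.MathematicalPhysics.QuantumFieldTheory.Balaban1983to89.B6Ineq2134DivNormSuppKLevelV1
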